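import Literature.AlgebraicGeometry.Motives.AbelianVarietyKummerPairing
import Literature.AlgebraicGeometry.Motives.CartierDivisorEffective
import Mathlib.FieldTheory.IsAlgClosed.Basic
import HarnessLib

/-!
# An effective divisor in the class of `k•Θ`, `k` even, INVARIANT under the `2`-torsion translations that fix the class of `Θ`
# («theta functions without theta groups»; [MumfordAV1970] §23, Thm. 3 at `n = 2`, first half)

Layer `Literature/AlgebraicGeometry/AbelianVarieties`, namespace `Literature.AlgebraicGeometry.AbelianVarieties.AbelianVariety`.
THEOREMS ONLY (no definition, no named fact, no instance, no notation, no `sorry`).  Cell hodgecm-mathlib (D-0151), F-DAG leaf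
F-6 (V) «(V)-upgrade» (director s224 (ii); census `B-provers/B-p03/g17/CENSUS-Vup-HalfOfLambda.B-p03g17.md`, file G1): the first
half of [MumfordAV1970] §23 Thm. 3 «`X[2] ⊆ K(L)` ⇒ `L` is a square» in the Kummer / Lang currency of ★
`Motives/AbelianVarietyKummerPairing` (rational functions, `t_x^♯`, everywhere-units are constants), with NO theta group, NO sheaf
isomorphism and NO cocycle.  HC_CM is proved only modulo the 7 printed citations until rung 0 closes; nothing here is about HC.

SETTING.  `A` an abelian variety over a field `K`, `Θ` a Cartier divisor on `A`, `T` a finite set of `K`-points `x` with `x·x = 1`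
lying in `K(Θ)`: `t_x^*Θ ∼ Θ`, witnessed by rational functions `g_x ≠ 0` with `Θ + div g_x = t_x^*Θ` (hypothesis `hR`, the unfolded
`SameDivisor`).  For `f ∈ K(A)` put `U_x f := g_x^k · t_x^♯ f` (written out; no definition is introduced).

* §1 `translation_left_translation_left_apply`, `translFF_translFF` — `t_y(t_x z) = t_{xy} z`, `t_x^♯ t_y^♯ = t_{xy}^♯` (★ `translation_comp'`,
  ★ `translFF_mul`).
* §2 `isSection_smul_mul_translFF` — `U_x` preserves `Γ(A, 𝒪(k•Θ)) ⊆ K(A)` (★ `CartierDivisor.IsSection`).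
* §3 `mul_translFF_mul_translFF_eq` — `U_x U_y f = c(x,y)^k · U_y U_x f` with `c(x,y) := g_x·t_x^♯g_y / (g_y·t_y^♯g_x)`;
  `isUnitAt_commutatorFn` — `c(x,y)` is a unit at every point (its numerator and denominator both cut out `t_{xy}^*Θ − Θ`), hence
  translation-fixed (★ `translFF_eq_self_of_forall_isUnitAt`); `isUnitAt_mul_translFF_self` — so is `d_x := g_x·t_x^♯g_x` when `x·x = 1`;
  `commutatorFn_mul_self` — **`c(x,y)² = 1` when `x·x = 1`** (`c·t_x^♯c = d_x / t_y^♯d_x`); hence `mul_translFF_comm` — for EVEN `k`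
  the operators `U_x`, `U_y` COMMUTE; `mul_translFF_mul_translFF_self` — `U_x U_x f = d_x^k · f`.  This is Mumford's «`e^{L²}` is trivial on
  `X_2`» ([MumfordAV1970] §23, p. 231: `e^{Lⁿ}(x, y) = e^L(x, y)ⁿ = e^L(nx, y) = 1`), for the commutator of translation operators on
  rational functions (Lang VII §2 / Milne §16 `ē`), where it is a one-line identity in the function field.
* §4 `exists_common_eigenfunction` — a non-zero common eigenfunction `w ∈ Γ(A, 𝒪(k•Θ))` of the `U_x`, `x ∈ T`, given one non-zero
  section `s₀` (`K` algebraically closed of characteristic `≠ 2`; induction on `T` with the two projections `U_x ± δ_x`, `δ_x² = d_x^k`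
  — no finite-dimensionality of `Γ(A, 𝒪(k•Θ))` is used).
* §5 **`exists_isSection_forall_sameDivisor_pullback_translation`** — THE HEAD: for even `k` and `T ⊆ A[2](K) ∩ K(Θ)` there is `w ≠ 0` with
  `E := k•Θ + div w` EFFECTIVE (`(k•Θ).IsSection w`, ★ `isEffective_add_principal_iff`) and `t_x^*E = E` AS DIVISORS
  (`(E.pullback t_x).SameDivisor E`) for every `x ∈ T` — the input of the descent along `A → A/A[2]` (census file G2).

## References
* [MumfordAV1970] D. Mumford, *Abelian Varieties* (1970), §23 Thm. 3 (p. 231) and its proof («`e^{Lⁿ}|_{X_n} ≡ 1`»), §6 App. 1.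
* [Lang1983AbelianVarieties] S. Lang, *Abelian Varieties*, Ch. VII §2 (translation operators on rational functions, `e_n`).
* [Milne1986AbelianVarieties] J. S. Milne, *Abelian varieties*, in Cornell–Silverman (1986), §16 (p. 132).
* [GortzWedhorn2023] U. Görtz, T. Wedhorn, *Algebraic Geometry II* (2023), Def. 27.280, Prop. 27.284 (polarization ⇔ symmetric with
  `(1, λ)^*𝒫` ample; the halving is deferred there to [DePa] 1.2).
-/

noncomputable section

open CategoryTheory AlgebraicGeometry

universe u

namespace Literature.AlgebraicGeometry.AbelianVarieties

namespace AbelianVariety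

open Literature.AlgebraicGeometry.Motives Literature.AlgebraicGeometry.Motives.RatFn
  Literature.AlgebraicGeometry.Motives.AbelianVariety Literature.AlgebraicGeometry.Motives.CartierDivisor

variable {K : Type u} [Field K] (A : Motives.AbelianVariety K)

/-! ## §1 Translations compose -/

/-- `t_y (t_x z) = t_{x·y} z` on points of the scheme (★ `translation_comp'`). [cite: MumfordAV1970, §23 (p. 231)] -/
theorem translation_left_translation_left_apply (x y : A.Points K) (z : A.X.left) :
    (A.translation y).left ((A.translation x).left z) = (A.translation (x * y)).left z := by
  have e : (A.translation (x * y)).left = (A.translation x).left ≫ (A.translation y).left := by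
    rw [← Over.comp_left, translation_comp']
  rw [e]; rfl

/-- `t_x^♯ (t_y^♯ f) = t_{x·y}^♯ f` (★ `translFF_mul`). [cite: MumfordAV1970, §23 (p. 231)] -/
theorem translFF_translFF (x y : A.Points K) (f : A.X.left.functionField) :
    A.translFF x (A.translFF y f) = A.translFF (x * y) f := by
  rw [translFF_mul]; rfl

/-- `t_x^♯ t_y^♯ = t_y^♯ t_x^♯` (`A` is commutative). [cite: MumfordAV1970, §23 (p. 231)] -/
theorem translFF_comm (x y : A.Points K) (f : A.X.left.functionField) :
    A.translFF x (A.translFF y f) = A.translFF y (A.translFF x f) := by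
  rw [translFF_translFF, translFF_translFF, mul_comm]

/-- `t_x^♯ t_x^♯ = id` when `x·x = 1`. [cite: MumfordAV1970, §23 (p. 231)] -/
theorem translFF_translFF_self {x : A.Points K} (hx : x * x = 1) (f : A.X.left.functionField) :
    A.translFF x (A.translFF x f) = f := by
  rw [translFF_translFF, hx, translFF_one]; rfl

variable (Θ : CartierDivisor A.X.left)

/-! ## §2 The operators `U_x f = g_x^k · t_x^♯ f` preserve `Γ(A, 𝒪(k•Θ))` -/

/-- If `Θ + div g = t_x^*Θ` (pointwise: `f_i · g / t_x^♯ f_j` is a unit at `y ∈ U_i ∩ t_x⁻¹U_j`) and `f ∈ Γ(A, 𝒪(k•Θ))`, then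
`g^k · t_x^♯ f ∈ Γ(A, 𝒪(k•Θ))`. [cite: MumfordAV1970, §23 Thm. 3 (p. 231)] -/
theorem isSection_smul_mul_translFF {x : A.Points K} {g : A.X.left.functionField}
    (hR : ∀ i j (y : A.X.left), y ∈ Θ.U i → (A.translation x).left y ∈ Θ.U j →
      IsUnitAt y (Θ.f i * g / A.translFF x (Θ.f j)))
    (k : ℕ) {f : A.X.left.functionField} (hf : (k • Θ).IsSection f) :
    (k • Θ).IsSection (g ^ k * A.translFF x f) := by
  intro i y hi
  obtain ⟨j, hj⟩ := Θ.covers ((A.translation x).left y)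
  have hu := (hR i j y hi hj).pow k
  have hr : IsRegularAt y (A.translFF x (Θ.f j ^ k * f)) := (hf j _ hj).functionFieldMap
  have hne : A.translFF x (Θ.f j) ≠ 0 := (map_ne_zero _).2 (Θ.f_ne_zero j)
  convert hu.isRegularAt.mul hr using 1
  simp only [smul_f]
  rw [map_mul, map_pow, div_pow, mul_pow, div_mul_eq_mul_div, eq_div_iff (pow_ne_zero k hne)]
  ring

/-! ## §3 The commutator constant `c(x,y)` and its triviality on `2`-torsion -/

/-- `U_x U_y f = c(x,y)^k · U_y U_x f` with `c(x,y) = g_x·t_x^♯g_y / (g_y·t_y^♯g_x)`. [cite: MumfordAV1970, §23 (p. 231)] -/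
theorem mul_translFF_mul_translFF_eq (x y : A.Points K) {gx gy : A.X.left.functionField} (hgy : gy ≠ 0)
    (hgx : gx ≠ 0) (k : ℕ) (f : A.X.left.functionField) :
    gx ^ k * A.translFF x (gy ^ k * A.translFF y f) =
      (gx * A.translFF x gy / (gy * A.translFF y gx)) ^ k * (gy ^ k * A.translFF y (gx ^ k * A.translFF x f)) := by
  have h1 : A.translFF y gx ≠ 0 := (map_ne_zero _).2 hgx
  simp only [map_mul, map_pow]
  rw [translFF_comm A x y f, div_pow, mul_pow, mul_pow, div_mul_eq_mul_div,
    eq_div_iff (mul_ne_zero (pow_ne_zero k hgy) (pow_ne_zero k h1))]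
  ring

/-- **`c(x,y)` is a unit at every point**: with `j ∋ z`, `i ∋ t_x z`, `i′ ∋ t_y z`, `l ∋ t_{xy} z`,
`c(x,y) = [f_j g_x / t_x^♯f_i]·t_x^♯[f_i g_y / t_y^♯f_l] / ([f_j g_y / t_y^♯f_{i′}]·t_y^♯[f_{i′} g_x / t_x^♯f_l])`, four units.
[cite: MumfordAV1970, §23 (p. 231)] -/
theorem isUnitAt_commutatorFn {x y : A.Points K} {gx gy : A.X.left.functionField} (hgx : gx ≠ 0) (hgy : gy ≠ 0)
    (hRx : ∀ i j (z : A.X.left), z ∈ Θ.U i → (A.translation x).left z ∈ Θ.U j →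
      IsUnitAt z (Θ.f i * gx / A.translFF x (Θ.f j)))
    (hRy : ∀ i j (z : A.X.left), z ∈ Θ.U i → (A.translation y).left z ∈ Θ.U j →
      IsUnitAt z (Θ.f i * gy / A.translFF y (Θ.f j)))
    (z : A.X.left) : IsUnitAt z (gx * A.translFF x gy / (gy * A.translFF y gx)) := by
  obtain ⟨j, hj⟩ := Θ.covers z
  obtain ⟨i, hi⟩ := Θ.covers ((A.translation x).left z)
  obtain ⟨i', hi'⟩ := Θ.covers ((A.translation y).left z)
  obtain ⟨l, hl⟩ := Θ.covers ((A.translation (x * y)).left z)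
  have a₁ := hRx j i z hj hi
  have hl₁ : (A.translation y).left ((A.translation x).left z) ∈ Θ.U l := by
    rw [translation_left_translation_left_apply]; exact hl
  have a₂ : IsUnitAt z (A.translFF x (Θ.f i * gy / A.translFF y (Θ.f l))) := (hRy i l _ hi hl₁).functionFieldMap
  have b₁ := hRy j i' z hj hi'
  have hl₂ : (A.translation x).left ((A.translation y).left z) ∈ Θ.U l := by
    rw [translation_left_translation_left_apply, mul_comm]; exact hl
  have b₂ : IsUnitAt z (A.translFF y (Θ.f i' * gx / A.translFF x (Θ.f l))) := (hRx i' l _ hi' hl₂).functionFieldMap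
  have key := (a₁.mul a₂).div (b₁.mul b₂)
  have h1 : A.translFF x (Θ.f i) ≠ 0 := (map_ne_zero _).2 (Θ.f_ne_zero i)
  have h2 : A.translFF y (Θ.f i') ≠ 0 := (map_ne_zero _).2 (Θ.f_ne_zero i')
  have h3 : A.translFF y (A.translFF x (Θ.f l)) ≠ 0 := (map_ne_zero _).2 ((map_ne_zero _).2 (Θ.f_ne_zero l))
  have h4 : A.translFF y gx ≠ 0 := (map_ne_zero _).2 hgx
  have h5 : A.translFF x gy ≠ 0 := (map_ne_zero _).2 hgy
  have h6 : Θ.f j ≠ 0 := Θ.f_ne_zero j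
  convert key using 1
  simp only [map_mul, map_div₀]
  rw [translFF_comm A x y (Θ.f l)]
  field_simp

/-- **`d_x := g_x · t_x^♯ g_x` is a unit at every point when `x·x = 1`** (`f_j · d_x / f_l` is the product of the units
`f_j g_x / t_x^♯f_i` and `t_x^♯(f_i g_x / t_x^♯ f_l)`, and `f_l / f_j` is a unit). [cite: MumfordAV1970, §23 (p. 231)] -/
theorem isUnitAt_mul_translFF_self {x : A.Points K} (hx : x * x = 1) {gx : A.X.left.functionField} (hgx : gx ≠ 0)
    (hRx : ∀ i j (z : A.X.left), z ∈ Θ.U i → (A.translation x).left z ∈ Θ.U j →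
      IsUnitAt z (Θ.f i * gx / A.translFF x (Θ.f j)))
    (z : A.X.left) : IsUnitAt z (gx * A.translFF x gx) := by
  obtain ⟨j, hj⟩ := Θ.covers z
  obtain ⟨i, hi⟩ := Θ.covers ((A.translation x).left z)
  have a₁ := hRx j i z hj hi
  have hl : (A.translation x).left ((A.translation x).left z) ∈ Θ.U j := by
    rw [translation_left_translation_left_apply, hx, translation_one]; exact hj
  have a₂ : IsUnitAt z (A.translFF x (Θ.f i * gx / A.translFF x (Θ.f j))) := (hRx i j _ hi hl).functionFieldMap
  have key := a₁.mul a₂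
  have h1 : A.translFF x (Θ.f i) ≠ 0 := (map_ne_zero _).2 (Θ.f_ne_zero i)
  have h6 : Θ.f j ≠ 0 := Θ.f_ne_zero j
  convert key using 1
  simp only [map_mul, map_div₀]
  rw [translFF_translFF_self A hx]
  field_simp

/-- **`c(x,y)·c(x,y) = 1` when `x·x = 1`**: `c·t_x^♯c = d_x / t_y^♯ d_x` and both `c`, `d_x` are translation-fixed (everywhere
units, ★ `translFF_eq_self_of_forall_isUnitAt`).  This is Mumford's `e^{L²}(x,y) = e^L(x,y)² = e^L(2x,y) = 1`.
[cite: MumfordAV1970, §23 Thm. 3 (p. 231)] -/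
theorem commutatorFn_mul_self {x y : A.Points K} (hx : x * x = 1) {gx gy : A.X.left.functionField} (hgx : gx ≠ 0)
    (hgy : gy ≠ 0)
    (hRx : ∀ i j (z : A.X.left), z ∈ Θ.U i → (A.translation x).left z ∈ Θ.U j →
      IsUnitAt z (Θ.f i * gx / A.translFF x (Θ.f j)))
    (hRy : ∀ i j (z : A.X.left), z ∈ Θ.U i → (A.translation y).left z ∈ Θ.U j →
      IsUnitAt z (Θ.f i * gy / A.translFF y (Θ.f j))) :
    (gx * A.translFF x gy / (gy * A.translFF y gx)) * (gx * A.translFF x gy / (gy * A.translFF y gx)) = 1 := by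
  set c := gx * A.translFF x gy / (gy * A.translFF y gx) with hc_def
  have hc : A.translFF x c = c := translFF_eq_self_of_forall_isUnitAt (isUnitAt_commutatorFn A Θ hgx hgy hRx hRy) x
  have hd : A.translFF y (gx * A.translFF x gx) = gx * A.translFF x gx :=
    translFF_eq_self_of_forall_isUnitAt (isUnitAt_mul_translFF_self A Θ hx hgx hRx) y
  have h4 : A.translFF y gx ≠ 0 := (map_ne_zero _).2 hgx
  have h5 : A.translFF x gy ≠ 0 := (map_ne_zero _).2 hgy
  have h7 : A.translFF y (A.translFF x gx) ≠ 0 := (map_ne_zero _).2 ((map_ne_zero _).2 hgx)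
  have hdne : gx * A.translFF x gx ≠ 0 := mul_ne_zero hgx ((map_ne_zero _).2 hgx)
  calc c * c = c * A.translFF x c := by rw [hc]
    _ = (gx * A.translFF x gx) / A.translFF y (gx * A.translFF x gx) := by
        rw [hc_def]
        simp only [map_mul, map_div₀]
        rw [translFF_translFF_self A hx, translFF_comm A x y gx]
        field_simp
    _ = 1 := by rw [hd, div_self hdne]

/-- **For even `k` the operators commute**: `U_x U_y f = U_y U_x f` (`x·x = 1`). [cite: MumfordAV1970, §23 Thm. 3 (p. 231)] -/
theorem mul_translFF_comm {x y : A.Points K} (hx : x * x = 1) {gx gy : A.X.left.functionField} (hgx : gx ≠ 0) (hgy : gy ≠ 0)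
    (hRx : ∀ i j (z : A.X.left), z ∈ Θ.U i → (A.translation x).left z ∈ Θ.U j →
      IsUnitAt z (Θ.f i * gx / A.translFF x (Θ.f j)))
    (hRy : ∀ i j (z : A.X.left), z ∈ Θ.U i → (A.translation y).left z ∈ Θ.U j →
      IsUnitAt z (Θ.f i * gy / A.translFF y (Θ.f j)))
    {k : ℕ} (hk : Even k) (f : A.X.left.functionField) :
    gx ^ k * A.translFF x (gy ^ k * A.translFF y f) = gy ^ k * A.translFF y (gx ^ k * A.translFF x f) := by
  obtain ⟨m, rfl⟩ := hk
  rw [mul_translFF_mul_translFF_eq A x y hgy hgx, ← two_mul, pow_mul, pow_two,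
    commutatorFn_mul_self A Θ hx hgx hgy hRx hRy, one_pow, one_mul]

/-- `U_x U_x f = d_x^k · f` when `x·x = 1`. [cite: MumfordAV1970, §23 (p. 231)] -/
theorem mul_translFF_mul_translFF_self {x : A.Points K} (hx : x * x = 1) (gx : A.X.left.functionField) (k : ℕ)
    (f : A.X.left.functionField) :
    gx ^ k * A.translFF x (gx ^ k * A.translFF x f) = (gx * A.translFF x gx) ^ k * f := by
  simp only [map_mul, map_pow]
  rw [translFF_translFF_self A hx]
  ring

/-! ## §4 A common eigenfunction -/

/-- **A non-zero common eigenfunction in `Γ(A, 𝒪(k•Θ))`** of the commuting operators `U_x`, `x ∈ T` (`K` algebraically closed,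
`2 ≠ 0`, `k` even), given one non-zero section `s₀`: induction on `T`, splitting the current eigenfunction `w` as
`(U_x w + δ w) + (U_x w − δ w)` with `δ² = d_x^k`. [cite: MumfordAV1970, §23 Thm. 3 (p. 231)] -/
theorem exists_common_eigenfunction [IsAlgClosed K] (h2 : (2 : K) ≠ 0) (T : Finset (A.Points K))
    (hT : ∀ x ∈ T, x * x = 1) (g : A.Points K → A.X.left.functionField) (hg : ∀ x ∈ T, g x ≠ 0)
    (hR : ∀ x ∈ T, ∀ i j (z : A.X.left), z ∈ Θ.U i → (A.translation x).left z ∈ Θ.U j →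
      IsUnitAt z (Θ.f i * g x / A.translFF x (Θ.f j)))
    {k : ℕ} (hk : Even k) {s₀ : A.X.left.functionField} (hs₀ : s₀ ≠ 0) (hs : (k • Θ).IsSection s₀) :
    ∃ w : A.X.left.functionField, w ≠ 0 ∧ (k • Θ).IsSection w ∧
      ∀ x ∈ T, ∃ μ : K, g x ^ k * A.translFF x w = algebraMap K A.X.left.functionField μ * w := by
  classical
  -- induction over sub-finsets of `T`
  suffices H : ∀ S : Finset (A.Points K), S ⊆ T → ∃ w : A.X.left.functionField, w ≠ 0 ∧ (k • Θ).IsSection w ∧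
      ∀ x ∈ S, ∃ μ : K, g x ^ k * A.translFF x w = algebraMap K A.X.left.functionField μ * w from
    H T le_rfl
  intro S
  induction S using Finset.induction_on with
  | empty => exact fun _ => ⟨s₀, hs₀, hs, fun x hx => absurd hx (Finset.notMem_empty x)⟩
  | insert x₀ S hx₀ ih =>
    intro hST
    have hx₀T : x₀ ∈ T := hST (Finset.mem_insert_self x₀ S)
    obtain ⟨w, hw0, hws, hw⟩ := ih ((Finset.subset_insert x₀ S).trans hST)
    -- the scalar `d₀^k` of `U_{x₀}²` and a square root `δ`
    obtain ⟨d₀, hd₀0, hd₀⟩ := exists_algebraMap_eq_of_forall_isUnitAt A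
      (isUnitAt_mul_translFF_self A Θ (hT x₀ hx₀T) (hg x₀ hx₀T) (hR x₀ hx₀T))
    obtain ⟨δ, hδ⟩ := IsAlgClosed.exists_pow_nat_eq (d₀ ^ k) two_pos
    have hδ0 : δ ≠ 0 := by
      rintro rfl
      rw [zero_pow two_ne_zero] at hδ
      exact pow_ne_zero k hd₀0 hδ.symm
    set aδ := algebraMap K A.X.left.functionField δ with haδ
    set Uw := g x₀ ^ k * A.translFF x₀ w with hUw
    have hUU : g x₀ ^ k * A.translFF x₀ Uw = aδ * aδ * w := by
      rw [hUw, mul_translFF_mul_translFF_self A (hT x₀ hx₀T), ← hd₀, ← map_pow, hδ.symm, haδ, ← map_mul, pow_two]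
    have hUlin : ∀ (x : A.Points K) (c : K) (v : A.X.left.functionField),
        g x ^ k * A.translFF x (algebraMap K _ c * v) = algebraMap K _ c * (g x ^ k * A.translFF x v) := by
      intro x c v
      rw [map_mul, translFF_algebraMap]; ring
    have hUadd : ∀ (x : A.Points K) (v v' : A.X.left.functionField),
        g x ^ k * A.translFF x (v + v') = g x ^ k * A.translFF x v + g x ^ k * A.translFF x v' := by
      intro x v v'; rw [map_add, mul_add]
    have hUsub : ∀ (x : A.Points K) (v v' : A.X.left.functionField),
        g x ^ k * A.translFF x (v - v') = g x ^ k * A.translFF x v - g x ^ k * A.translFF x v' := by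
      intro x v v'; rw [map_sub, mul_sub]
    -- the two candidates
    have hUw0 : Uw ≠ 0 := mul_ne_zero (pow_ne_zero k (hg x₀ hx₀T)) ((map_ne_zero _).2 hw0)
    have hsec : ∀ v, (k • Θ).IsSection v → (k • Θ).IsSection (g x₀ ^ k * A.translFF x₀ v) :=
      fun v hv => isSection_smul_mul_translFF A Θ (hR x₀ hx₀T) k hv
    have hcand : ∀ ε : K, ε * ε = δ * δ → Uw + algebraMap K _ ε * w ≠ 0 →
        ∃ w' : A.X.left.functionField, w' ≠ 0 ∧ (k • Θ).IsSection w' ∧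
          ∀ x ∈ insert x₀ S, ∃ μ : K, g x ^ k * A.translFF x w' = algebraMap K A.X.left.functionField μ * w' := by
      intro ε hε hne
      refine ⟨Uw + algebraMap K _ ε * w, hne, ?_, ?_⟩
      · have h1 : Uw + algebraMap K _ ε * w ∈ (k • Θ).sections K :=
          add_mem (hsec w hws) (Submodule.smul_mem _ ε hws)
        exact h1
      · intro x hx
        rcases Finset.mem_insert.1 hx with rfl | hxS
        · refine ⟨ε, ?_⟩
          rw [hUadd, hUU, hUlin, ← hUw, haδ, ← map_mul, ← hε, map_mul]
          ring
        · obtain ⟨μ, hμ⟩ := hw x hxS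
          refine ⟨μ, ?_⟩
          have hcomm : g x ^ k * A.translFF x Uw = g x₀ ^ k * A.translFF x₀ (g x ^ k * A.translFF x w) :=
            mul_translFF_comm A Θ (hT x (hST hx)) (hg x (hST hx)) (hg x₀ hx₀T) (hR x (hST hx)) (hR x₀ hx₀T) hk w
          rw [hUadd, hcomm, hμ, hUlin, hUlin, hμ, ← hUw]
          ring
    by_cases hplus : Uw + aδ * w = 0
    · have hminus : Uw + algebraMap K _ (-δ) * w ≠ 0 := by
        intro h0
        have hsum : (2 : A.X.left.functionField) * Uw = 0 := by
          have := congrArg₂ (· + ·) hplus h0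
          simp only [add_zero, map_neg, haδ] at this
          linear_combination this
        rcases mul_eq_zero.1 hsum with h | h
        · exact h2 ((algebraMap K A.X.left.functionField).injective (by rw [map_ofNat, map_zero]; exact h))
        · exact hUw0 h
      exact hcand (-δ) (by ring) hminus
    · exact hcand δ rfl hplus

/-! ## §5 The invariant effective divisor -/

/-- **THE HEAD.  An effective divisor `E = k•Θ + div w` in the class of `k•Θ` (`k` even) with `t_x^*E = E` AS DIVISORS for every
`x` in a finite set `T ⊆ A[2](K) ∩ K(Θ)`** (`K` algebraically closed with `2 ≠ 0`; `s₀` a non-zero section of `𝒪(k•Θ)`): the divisor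
of a common eigenfunction of the commuting translation operators `U_x f = g_x^k·t_x^♯f` on `Γ(A, 𝒪(k•Θ))`.  First half of
[MumfordAV1970] §23 Thm. 3 at `n = 2` — the level subgroup over `X_2` for `L²` — in the currency of rational functions; the descent
of `E` along `A → A/A[2]` is the sequel. [cite: MumfordAV1970, §23 Thm. 3 (p. 231)] [cite: Lang1983AbelianVarieties, Ch. VII §2] -/
theorem exists_isSection_forall_sameDivisor_pullback_translation [IsAlgClosed K] (h2 : (2 : K) ≠ 0)
    (T : Finset (A.Points K)) (hT : ∀ x ∈ T, x * x = 1)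
    (hKΘ : ∀ x ∈ T, (Θ.pullback (A.translation x).left).LinEquiv Θ)
    {k : ℕ} (hk : Even k) {s₀ : A.X.left.functionField} (hs₀ : s₀ ≠ 0) (hs : (k • Θ).IsSection s₀) :
    ∃ (w : A.X.left.functionField) (hw : w ≠ 0), (k • Θ).IsSection w ∧
      ∀ x ∈ T, ((k • Θ + principal w hw).pullback (A.translation x).left).SameDivisor (k • Θ + principal w hw) := by
  classical
  -- choose `g_x` with `Θ + div g_x = t_x^*Θ`
  have hch : ∀ x ∈ T, ∃ g : A.X.left.functionField, g ≠ 0 ∧ ∀ i j (z : A.X.left), z ∈ Θ.U i →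
      (A.translation x).left z ∈ Θ.U j → IsUnitAt z (Θ.f i * g / A.translFF x (Θ.f j)) := by
    intro x hx
    obtain ⟨h, hh, H⟩ := (linEquiv_iff _ _).1 (hKΘ x hx)
    refine ⟨h⁻¹, inv_ne_zero hh, fun i j z hi hj => ?_⟩
    have := (H j i z hj hi).inv
    convert this using 1
    rw [pullback_f, inv_div]
    change Θ.f i * h⁻¹ / A.translFF x (Θ.f j) = Θ.f i / (A.translFF x (Θ.f j) * h)
    field_simp
  choose! g hg0 hR using hch
  obtain ⟨w, hw0, hws, hw⟩ := exists_common_eigenfunction A Θ h2 T hT g hg0 hR hk hs₀ hs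
  refine ⟨w, hw0, hws, fun x hx => ?_⟩
  obtain ⟨μ, hμ⟩ := hw x hx
  have hμ0 : μ ≠ 0 := by
    rintro rfl
    rw [map_zero, zero_mul] at hμ
    exact mul_ne_zero (pow_ne_zero k (hg0 x hx)) ((map_ne_zero _).2 hw0) hμ
  have htw : A.translFF x w = algebraMap K _ μ * w / g x ^ k := by
    rw [← hμ]; field_simp [pow_ne_zero k (hg0 x hx)]
  have hμu : ∀ z : A.X.left, IsUnitAt z (algebraMap K A.X.left.functionField μ) := fun z =>
    (isUnitAt_iff).2 ⟨(map_ne_zero _).2 hμ0, isRegularAt_algebraMap z μ, by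
      rw [← map_inv₀]; exact isRegularAt_algebraMap z μ⁻¹⟩
  rintro ⟨i, ⟨⟩⟩ ⟨j, ⟨⟩⟩ z ⟨hi, -⟩ ⟨hj, -⟩
  have hu := ((hR x hx j i z hj hi).pow k).inv.mul (hμu z)
  have h1 : A.translFF x (Θ.f i) ≠ 0 := (map_ne_zero _).2 (Θ.f_ne_zero i)
  have h6 : Θ.f j ≠ 0 := Θ.f_ne_zero j
  have hgk : g x ^ k ≠ 0 := pow_ne_zero k (hg0 x hx)
  have hg' : g x ≠ 0 := hg0 x hx
  convert hu using 1
  simp only [pullback_f, add_def, CartierDivisor.add, smul_f, principal, map_mul, map_pow]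
  change A.translFF x (Θ.f i) ^ k * A.translFF x w / (Θ.f j ^ k * w) = _
  rw [htw]
  have hti : (A.translFF x (Θ.f i))⁻¹ ^ k * A.translFF x (Θ.f i) ^ k = 1 := by
    rw [inv_pow, inv_mul_cancel₀ (pow_ne_zero k h1)]
  field_simp
  linear_combination ((algebraMap K A.X.left.functionField) μ * Θ.f j ^ k * g x ^ k) * hti

end AbelianVariety

end Literature.AlgebraicGeometry.AbelianVarieties
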